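import Summits.Ventures.LatticeQCDFlow.Exactness.FlowSamplerMixtureConvexity
import Summits.Ventures.LatticeQCDFlow.Exactness.Phi4LatticeSymmetry
import HarnessLib

/-!
# Lattice φ⁴: pooling several trained flows into one mixture proposal never rejects more on average, and never has larger training loss or forward KL, than the weighted average of the single flows

HONEST FRAMING: exact (Metropolis-corrected) sampling algorithms for lattice gauge theory;
figures of merit are autocorrelation/cost numbers at stated couplings and volumes; no
continuum-physics claim.  (SCALAR calibration rung S0-A: not a gauge result.)

Venture `LatticeQCDFlow` (cell pub-lqcd), topic `Exactness`; FANOUT row 2 (`s0-phi4`, FLOW arm).  NEW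
WORK of the cell: the lattice instances of `FlowSamplerMixtureConvexity` for lattice φ⁴ (`n + 1` sites,
`S = Σ φJφ + λΣφ⁴`, ANY `λ > 0`, real `J`), finitely many positive normalised flow densities `q̃ᵢ` and
weights `αᵢ > 0`, `Σ αᵢ = 1`, mixture `q̄ = Σ αᵢq̃ᵢ`:

* **`phi4FlowMixture_meanRejection_le`** — `∫ r_q̄ e^{−S} ≤ Σ αᵢ ∫ r_{q̃ᵢ} e^{−S}`: the mixture
  sampler's mean rejection (unnormalised, against `e^{−S}`) is at most the weighted average;
* **`phi4FlowMixture_reverseKL_le`** — `∫ q̄ log(q̄/e^{−S}) ≤ Σ αᵢ ∫ q̃ᵢ log(q̃ᵢ/e^{−S})` whenever each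
  component's training loss is finite (integrable): the mixture's TRAINING LOSS (reverse KL up to
  `log Z`) is at most the weighted average of the components';
* **`phi4FlowMixture_forwardKL_le`** — `∫ e^{−S} log(e^{−S}/q̄) ≤ Σ αᵢ ∫ e^{−S} log(e^{−S}/q̃ᵢ)`.

Companions: `Phi4FlowMixtureHarmonicMean` (`τ + ½ ≤` harmonic mean).  Nothing is cited as a fact.

NOT CLAIMED: that the mixture beats its best component; cost (every `q̃ᵢ` evaluated per proposal); any
value for any network.
-/

namespace Summit.Ventures.LatticeQCDFlow.Exactness

open Real MeasureTheory Filter Finset Topology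
open Summit.Ventures.LatticeQCDFlow.Scoring

variable {n : ℕ} {ι : Type*} [Fintype ι] [Nonempty ι]

/-- **The mixture sampler's mean rejection is at most the weighted average of the single flows'.** -/
theorem phi4FlowMixture_meanRejection_le {lam : ℝ} (hlam : 0 < lam)
    (J : Fin (n + 1) → Fin (n + 1) → ℝ) {q : ι → (Fin (n + 1) → ℝ) → ℝ}
    (hq0 : ∀ i φ, 0 < q i φ) (hqm : ∀ i, Measurable (q i)) (hqi : ∀ i, Integrable (q i))
    (hq1 : ∀ i, ∫ φ, q i φ = 1) {α : ι → ℝ} (hα : ∀ i, 0 < α i) (hα1 : ∑ i, α i = 1) :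
    ∫ φ, (∫ ψ, (1 - imhAcceptQ (gibbsWeight J lam) (fun s => ∑ i, α i * q i s) φ ψ)
        * (∑ i, α i * q i ψ)) * gibbsWeight J lam φ
      ≤ ∑ i, α i * ∫ φ, (∫ ψ, (1 - imhAcceptQ (gibbsWeight J lam) (q i) φ ψ) * q i ψ)
        * gibbsWeight J lam φ :=
  finMixture_meanRejection_le (μ := volume) hα hα1 (fun φ => gibbsWeight_pos J lam φ)
    (continuous_gibbsWeight J lam).measurable (integrable_gibbsWeight hlam J) hq0 hqm hqi hq1

/-- **The mixture's training loss (reverse KL against `e^{−S}`, up to `log Z`) is at most the weighted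
average of the components'** — integrability of the mixture's integrand included. -/
theorem phi4FlowMixture_reverseKL_le {lam : ℝ} (hlam : 0 < lam)
    (J : Fin (n + 1) → Fin (n + 1) → ℝ) {q : ι → (Fin (n + 1) → ℝ) → ℝ}
    (hq0 : ∀ i φ, 0 < q i φ) (hqm : ∀ i, Measurable (q i)) (hqi : ∀ i, Integrable (q i))
    {α : ι → ℝ} (hα : ∀ i, 0 < α i) (hα1 : ∑ i, α i = 1)
    (hKL : ∀ i, Integrable (fun φ => q i φ * Real.log (q i φ / gibbsWeight J lam φ))) :
    Integrable (fun φ => (∑ i, α i * q i φ) * Real.log ((∑ i, α i * q i φ) / gibbsWeight J lam φ)) ∧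
    ∫ φ, (∑ i, α i * q i φ) * Real.log ((∑ i, α i * q i φ) / gibbsWeight J lam φ)
      ≤ ∑ i, α i * ∫ φ, q i φ * Real.log (q i φ / gibbsWeight J lam φ) :=
  finMixture_reverseKL_le (μ := volume) hα hα1 (fun φ => gibbsWeight_pos J lam φ)
    (continuous_gibbsWeight J lam).measurable (integrable_gibbsWeight hlam J) hq0 hqm hqi hKL

/-- **The mixture's forward KL (from `e^{−S}`, unnormalised) is at most the weighted average.** -/
theorem phi4FlowMixture_forwardKL_le {lam : ℝ} (hlam : 0 < lam)
    (J : Fin (n + 1) → Fin (n + 1) → ℝ) {q : ι → (Fin (n + 1) → ℝ) → ℝ}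
    (hq0 : ∀ i φ, 0 < q i φ) (hqm : ∀ i, Measurable (q i)) (hqi : ∀ i, Integrable (q i))
    {α : ι → ℝ} (hα : ∀ i, 0 < α i) (hα1 : ∑ i, α i = 1)
    (hKL : ∀ i, Integrable (fun φ => gibbsWeight J lam φ * Real.log (gibbsWeight J lam φ / q i φ))) :
    Integrable (fun φ => gibbsWeight J lam φ * Real.log (gibbsWeight J lam φ / ∑ i, α i * q i φ)) ∧
    ∫ φ, gibbsWeight J lam φ * Real.log (gibbsWeight J lam φ / ∑ i, α i * q i φ)
      ≤ ∑ i, α i * ∫ φ, gibbsWeight J lam φ * Real.log (gibbsWeight J lam φ / q i φ) :=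
  finMixture_forwardKL_le (μ := volume) hα hα1 (fun φ => gibbsWeight_pos J lam φ)
    (continuous_gibbsWeight J lam).measurable (integrable_gibbsWeight hlam J) hq0 hqm hqi hKL

end Summit.Ventures.LatticeQCDFlow.Exactness
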